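import Summits.Schanuel.Schanuel.Theorems.RootDecomp1KXLinear05

/-!
# RootDecomp1KLevelFinite — lens 1, generation 51, node 10 «LEVEL FINITENESS: the thin-fibre residual ThinFibre m₀ (ALL P ≠ 0, EVERY m₀ ≥ 2) GRADED BY SIEGEL'S EXCEPTIONAL CLASSES» — part 1 (RootDecomp1KLevelFinite01): §0 truncations sQ + §1 LevelFinite and the proved glue to ThinFibre / (b)

(lens-1 g51 HOME kernel K = HOME/decomp-schanuel-lens-1/g51/LevelFinite.lean b1fbaeff…, 843 l, ONE import …RootDecomp1KXLinear05 BY NAME; P LevelFiniteProbe.lean 6077dbab… rc 0 / C₀ LevelFiniteCtrl0.lean 388c6d35… rc 0 / C LevelFiniteCtrl.lean 6b696b71… rc 1 = 16 planted; memo NODE-g51.md ed9ba755…; CLAIM L2477, EX-ANTE PRICE + CHECKLIST K-g51 L2478, NODE L2479 / REQUEST L2480, writer re-check L2481, critic VERDICT L2482: CLEARED AS PRICED EX ANTE — ONE THEOREM ×1 «LEVEL-FINITENESS REDUCTION», RULE K-R40, PORT GO. Port by census-1 gen 21 as `RootDecomp1KLevelFinite01–04` along K's §0–§7: 01 = §0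 the truncations `sQ` + §1 `LevelFinite` (def) and the PROVED glue `thinFibre_of_levelFinite` / (b); 02 = §2 the Siegel–Mahler trichotomy typed to consumption shape (`IsDyadic`, `NormShapeHyp`, `SiegelShapes` [requested Literature fact, cite item wi-102309], `LaurentShapeLF`, `TwoAdicBounded`, `NormShapeLFNonsplit`, `NormShapeLFSplitImag` [hypothesis, ATTACKABLE], `NormShapeLFSplitReal` [hypothesis, FACT-NEEDED, cite item wi-102310], `NormShapeLevels`) + §3 the one-pole shape PROVED from the tree's `levels_finite` (Ridout by tree name); 03 = §4 the assembly `levelFinite_of_siegelShapes` / `thinFibre_of_siegelShapes` / `b_of_siegelShapes` + §5 the two-rational-poles shape PROVED hyp-free (`laurentShapeLF_holds`); 04 = §6 headline corollaries + §7 the non-split conjugate-poles grade PROVED (`normShapeLFNonsplit_holds`) and the primed headline corollaries. PORT EDITS (census convention, pre-sanctioned L2482): `isCoprime_num_den` PRIVATISED (verbatim twin of `Literature.NumberTheory.DiophantineApproximation.SparseDyadicRationals.isCoprime_num_den`, writer flag (α)); `padicValInt_two_pow` (v₂(xⁿ) = n·v₂(x)) privatised + documented (generic one-liner; a DIFFERENT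 statement under the same short name is private in CollarCell01 / CollarWall01); docstrings added on `thinFibre_of_siegelShapes'` / `b_of_siegelShapes'`; per-part private copies if any; K carries no `set_option` (its 52 dupNamespace lint warnings are HOME-path artefacts, 0 in the tree build); statements and proofs otherwise verbatim, no renames, no heartbeat lines. `--supports stmt-Schanuel-33364`; no census credit carried; rung 0 — nothing here proves Schanuel, 33364, 31077, 33363, ThinFibre m₀ or the (b)-cell hypothesis-free.)
-/

/-!
# RootDecomp1KLevelFinite — lens 1, generation 51, node 10 «LEVEL FINITENESS: the thin-fibre residual
(K-R36 (ii)/(iii)) GRADED BY SIEGEL'S EXCEPTIONAL CLASSES» (CLAIM L2477)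

HOME kernel K of lens-1 g51.  The K-line's residual at FIXED Skel-quality, `ThinFibre m₀` (tree
`RootDecomp1KDegreeLadder06`, OPEN for every `m₀ ≥ 2`, FALSE for `m₀ ≤ 1`), is reduced here — with PROVED glue —
to ONE Diophantine finiteness statement per prime curve, `LevelFinite P` («only finitely many truncations `s_N` of
`ℓ₂` are `x`-coordinates of rational points of `P = 0`»), and `LevelFinite` is decomposed along the SIEGEL–MAHLER
trichotomy for curves with infinitely many `{2,∞}`-integral points (non-exceptional / one pole / two rational poles /
two conjugate poles), typed to consumption shape over the tree's vocabulary (`bev`, `ℤ[X]`, `aeval`; no genus, no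
number field).  What is PROVED hypothesis-free (0 sorry): the glue `LevelFinite ∀ prime ⟹ ThinFibre m₀ ∀ m₀ ≥ 2 ⟹ (b) ∀ m₀ ≥ 2
⟹ SB 2 (ℓ₂, ρ)` + the item-31077 pair cell for every `ρ ∈ ⋃_{m ≥ 2} SkelFix m` (§1), the assembly
`levelFinite_of_shapes` (§4), and THREE of the five shape pieces: the one-pole piece `polyShapeLF` (§3, Ridout via the
tree's node-2 theorem `levels_finite`), the two-rational-poles piece `laurentShapeLF_holds` (§5, elementary) and the
non-split conjugate-poles grade `normShapeLFNonsplit_holds` (§7, elementary `2`-adic bookkeeping).  What is TYPED and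
TAGGED, not proved (the binders of the headline corollaries `…_of_siegelShapes'`, §7 end): the Siegel–Mahler–Lang input
`SiegelShapes` ([hypothesis] FACT-corollary, INFRASTRUCTURE-NEEDED; cite item wi-102309), the split-definite grade
`NormShapeLFSplitImag` ([hypothesis], ATTACKABLE: elementary arithmetic of an imaginary quadratic field, paper proof in
NODE-g51.md §3.4) and the split-indefinite grade `NormShapeLFSplitReal` ([hypothesis], FACT-NEEDED ⟸ `p`-adic linear
forms in three logarithms, van der Poorten / Yu; cite item wi-102310; g47's residual (δ) `q = t² − 17` lives here).
Nothing in this file proves Schanuel, `FiniteOrderLiouvilleSchanuel` (33364), `CoordLiouvilleSchanuel` (31077),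
`HyperLiouvilleSchanuel` (33363), `ThinFibre m₀` or the (b)-cell hypothesis-free.
-/

noncomputable section

open Polynomial LiouvilleNumber
open scoped Nat

namespace Summit.Schanuel.Schanuel.Theorems.RootDecomp1KLevelFinite

open Summit.Schanuel.Schanuel.Theorems.RootDecomp1KSkelCell (iota SkelLiouville SkelLiouvilleFix
  skelLiouville_iff_fix SkelLiouvilleFix.mono)
open Summit.Schanuel.Schanuel.Theorems.RootDecomp1KTwoBaseCell (psNumer partialSum_eq_psNumer_div coprime_psNumer
  sb_of_range_eq')
open Summit.Schanuel.Schanuel.Theorems.RootDecomp1KRelLiouvilleCell (partialSum_two_strictMono)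
open Summit.Schanuel.Schanuel.Theorems.RootDecomp1KDegreeLadder
open Summit.Schanuel.Schanuel.Theorems.RootDecomp1KXLinear (xLinP bev_xLinP aeval_ratCast levels_finite
  thinFibreAt_mul_left)
open Summit.Schanuel.Schanuel.Theorems.RootDecomp1KHyper (SB SFset sb_of_algebraicIndependent)

/-! ## §0  The rational truncations `sQ N = p_N / 2^{N!}` of `ℓ₂` -/

/-- [auxiliary] the `N`-th truncation of `ℓ₂` as a RATIONAL number, `sQ N = psNumer 2 N / 2^{N!}`. -/
def sQ (N : ℕ) : ℚ := (psNumer 2 N : ℚ) / 2 ^ N !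

/-- `(sQ N : ℝ) = partialSum 2 N`. -/
theorem sQ_cast (N : ℕ) : ((sQ N : ℚ) : ℝ) = partialSum 2 N := by
  have := partialSum_eq_psNumer_div (b := 2) (by norm_num) N
  rw [sQ]
  push_cast
  simpa using this.symm

/-- `N ↦ sQ N` is injective (the truncations are strictly increasing). -/
theorem sQ_injective : Function.Injective sQ := by
  intro N N' h
  have h2 : partialSum 2 N = partialSum 2 N' := by rw [← sQ_cast, ← sQ_cast, h]
  exact partialSum_two_strictMono.injective h2

/-- The preimage of a finite set of rationals under `sQ` is a finite set of levels. -/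
theorem finite_levels_of_finite {F : Set ℚ} (hF : F.Finite) : {N : ℕ | sQ N ∈ F}.Finite :=
  hF.preimage (sQ_injective.injOn)

/-! ## §1  LEVEL FINITENESS and the glue to `ThinFibre m₀` (all `m₀ ≥ 2`) and to (b) — PROVED -/

/-- [auxiliary predicate] the LEVEL SET of `P` below height `C`: the levels `N` at which the level curve
`P(s_N, ·) = 0` has a NON-DEGENERATE rational point `r` with `|r| ≤ C` (definition with parameters, not a fact). -/
def LevelSet (P : ℤ[X][X]) (C : ℝ) : Set ℕ :=
  {N | ∃ r : ℚ, |(r : ℝ)| ≤ C ∧ bev P (partialSum 2 N) r = 0 ∧ ∃ x : ℝ, bev P x r ≠ 0}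

/-- [residual class] statement def (census convention): **LEVEL FINITENESS of `P`** — every level set of `P` is
FINITE: only finitely many truncations `s_N` of `ℓ₂` are `x`-coordinates of non-degenerate rational points of
bounded height on `P = 0`.  (Strictly stronger than `ThinFibreAt m₀ P` for every `m₀`: `thinFibreAt_of_levelFinite`;
for prime `P` of `Y`-degree `≥ 2` it is the conclusion of the Siegel decomposition §3–§5.) -/
def LevelFinite (P : ℤ[X][X]) : Prop :=
  ∀ C : ℝ, (LevelSet P C).Finite

/-- Level finiteness gives the thin-fibre clause at EVERY quality `m₀` (beyond the last level the clause is vacuous). -/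
theorem thinFibreAt_of_levelFinite {P : ℤ[X][X]} (h : LevelFinite P) (m₀ : ℕ) : ThinFibreAt m₀ P := by
  intro C
  obtain ⟨N₀, hN₀⟩ := (h C).bddAbove
  refine ⟨N₀ + 1, fun N hN r hr hP hx => ?_⟩
  exact absurd (hN₀ ⟨r, hr, hP, hx⟩) (by omega)

/-- Level sets are sub-multiplicative: a level of `P·Q` is a level of `P` or of `Q`. -/
theorem levelSet_mul_subset (P Q : ℤ[X][X]) (C : ℝ) :
    LevelSet (P * Q) C ⊆ LevelSet P C ∪ LevelSet Q C := by
  rintro N ⟨r, hr, hzero, x, hx⟩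
  rw [bev_mul] at hzero hx
  rcases mul_eq_zero.mp hzero with h | h
  · exact Or.inl ⟨r, hr, h, x, left_ne_zero_of_mul hx⟩
  · exact Or.inr ⟨r, hr, h, x, right_ne_zero_of_mul hx⟩

/-- `LevelFinite` is multiplicative. -/
theorem LevelFinite.mul {P Q : ℤ[X][X]} (hP : LevelFinite P) (hQ : LevelFinite Q) : LevelFinite (P * Q) :=
  fun C => ((hP C).union (hQ C)).subset (levelSet_mul_subset P Q C)

/-- `ThinFibreAt m₀` is multiplicative. -/
theorem ThinFibreAt.mul {m₀ : ℕ} {P Q : ℤ[X][X]} (hP : ThinFibreAt m₀ P) (hQ : ThinFibreAt m₀ Q) :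
    ThinFibreAt m₀ (P * Q) := by
  intro C
  obtain ⟨N₁, hN₁⟩ := hP C
  obtain ⟨N₂, hN₂⟩ := hQ C
  refine ⟨max N₁ N₂, fun N hN r hr hzero hnd => ?_⟩
  obtain ⟨x, hx⟩ := hnd
  rw [bev_mul] at hzero hx
  rcases mul_eq_zero.mp hzero with h | h
  · exact hN₁ N (le_of_max_le_left hN) r hr h ⟨x, left_ne_zero_of_mul hx⟩
  · exact hN₂ N (le_of_max_le_right hN) r hr h ⟨x, right_ne_zero_of_mul hx⟩

/-- Units of `ℤ[X][Y]` have no level points: the clause holds vacuously. -/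
theorem thinFibreAt_of_isUnit {m₀ : ℕ} {u : ℤ[X][X]} (hu : IsUnit u) : ThinFibreAt m₀ u := by
  intro C₀
  refine ⟨0, fun N _ r _ hzero _ => ?_⟩
  obtain ⟨v, hv⟩ := hu.exists_right_inv
  have h1 : bev (u * v) (partialSum 2 N) r = 1 := by
    have e1 : (1 : ℤ[X][X]) = Polynomial.C (Polynomial.C 1) := by simp
    rw [hv, e1, bev_C]
    simp
  rw [bev_mul, hzero, zero_mul] at h1
  exact absurd h1 zero_ne_one

/-- **REDUCTION TO PRIME CURVES OF `Y`-DEGREE `≥ 2`** (PROVED): if the clause at quality `m₀ ≥ 2` holds for every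
PRIME `P ∈ ℤ[X][Y]` of `Y`-degree `≥ 2`, it holds for every `P ≠ 0` — `ℤ[X][Y]` is factorial, the clause is
multiplicative, units have no level points, and primes of `Y`-degree `≤ 1` are free (`thinFibreAt_of_natDegree_lt`). -/
theorem thinFibre_of_prime {m₀ : ℕ} (hm : 2 ≤ m₀)
    (H : ∀ P : ℤ[X][X], Prime P → 2 ≤ P.natDegree → ThinFibreAt m₀ P) : ThinFibre m₀ := by
  intro P hP0
  revert hP0
  refine UniqueFactorizationMonoid.induction_on_prime P (fun h => absurd rfl h) (fun u hu _ => thinFibreAt_of_isUnit hu)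
    (fun a p ha hp ih _ => ?_)
  have hp' : ThinFibreAt m₀ p := by
    by_cases hd : 2 ≤ p.natDegree
    · exact H p hp hd
    · exact thinFibreAt_of_natDegree_lt (by omega)
  exact ThinFibreAt.mul hp' (ih ha)

/-- **LEVEL FINITENESS ⟹ THIN FIBRES AT EVERY QUALITY `m₀ ≥ 2`** (PROVED). -/
theorem thinFibre_of_levelFinite (H : ∀ P : ℤ[X][X], Prime P → 2 ≤ P.natDegree → LevelFinite P)
    {m₀ : ℕ} (hm : 2 ≤ m₀) : ThinFibre m₀ :=
  thinFibre_of_prime hm fun P hP hd => thinFibreAt_of_levelFinite (H P hP hd) m₀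

/-- **LEVEL FINITENESS ⟹ (b) AT EVERY FIXED QUALITY `m₀ ≥ 2`** (PROVED; tree glue `thinFibre_imp_b`): algebraic
independence of `(ℓ₂, ρ)` for every `ρ` in the FIXED-multiple class `SkelFix m₀`, `m₀ ≥ 2` — a class strictly larger
than `Skel = ⋂ₘ SkelFix m` (tree `skelLiouville_iff_fix`), where the tree decides it hypothesis-free. -/
theorem b_of_levelFinite (H : ∀ P : ℤ[X][X], Prime P → 2 ≤ P.natDegree → LevelFinite P)
    {m₀ : ℕ} (hm : 2 ≤ m₀) (ρ : ℝ) (hρ : SkelLiouvilleFix m₀ ρ) :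
    AlgebraicIndependent ℚ ![((liouvilleNumber 2 : ℝ) : ℂ), (ρ : ℂ)] :=
  thinFibre_imp_b (by omega) (thinFibre_of_levelFinite H hm) ρ hρ

/-- From (b) to Schanuel's bound at the pair: `SB 2 (ℓ₂, ρ)`. -/
theorem sb_pair_of_algebraicIndependent {ρ : ℝ}
    (hai : AlgebraicIndependent ℚ ![((liouvilleNumber 2 : ℝ) : ℂ), (ρ : ℂ)]) :
    SB 2 ![((liouvilleNumber 2 : ℝ) : ℂ), (ρ : ℂ)] := by
  refine sb_of_algebraicIndependent hai (by simp) fun i => ?_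
  refine IntermediateField.subset_adjoin ℚ _ (Or.inl (Or.inl ⟨i, ?_⟩))
  fin_cases i <;> rfl

/-- **THE (b)-CELL MODULO LEVEL FINITENESS**: `SB 2 (ℓ₂, ρ)` for every `ρ ∈ SkelFix m₀`, every `m₀ ≥ 2`. -/
theorem sb_pair_of_levelFinite (H : ∀ P : ℤ[X][X], Prime P → 2 ≤ P.natDegree → LevelFinite P)
    {m₀ : ℕ} (hm : 2 ≤ m₀) {ρ : ℝ} (hρ : SkelLiouvilleFix m₀ ρ) :
    SB 2 ![((liouvilleNumber 2 : ℝ) : ℂ), (ρ : ℂ)] :=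
  sb_pair_of_algebraicIndependent (b_of_levelFinite H hm ρ hρ)

/-- **ITEM 31077 ON THE PAIR `(ℓ₂, ρ)`, `ρ ∈ SkelFix m₀`, `m₀ ≥ 2` — MODULO LEVEL FINITENESS.**  Binders of
`Summit.Schanuel.Schanuel.Theses.RootDecomp1K.CoordLiouvilleSchanuel` VERBATIM with ONE cell line
`Set.range z = Set.range ![ℓ₂, ρ]` (`ℓ₂` is the Liouville coordinate of the scope). -/
theorem coordLiouvilleSchanuel_pair_of_levelFinite
    (H : ∀ P : ℤ[X][X], Prime P → 2 ≤ P.natDegree → LevelFinite P)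
    {m₀ : ℕ} (hm : 2 ≤ m₀) {ρ : ℝ} (hρ : SkelLiouvilleFix m₀ ρ) :
    ∀ (n : ℕ) (z : Fin n → ℂ), LinearIndependent ℚ z →
      Set.range z = Set.range ![((liouvilleNumber 2 : ℝ) : ℂ), (ρ : ℂ)] →
      (∃ w ∈ Submodule.span ℚ (Set.range z), Liouville w.re ∨ Liouville w.im) →
      (n : Cardinal) ≤ Algebra.trdeg ℚ
        ↥(IntermediateField.adjoin ℚ (Set.range z ∪ Set.range (Complex.exp ∘ z))) := by
  intro n z hz hrange _
  exact sb_of_range_eq' hz.injective hrange (sb_pair_of_levelFinite H hm hρ)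

end Summit.Schanuel.Schanuel.Theorems.RootDecomp1KLevelFinite

end
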